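import Literature.RingTheory.MvPowerSeries.MaximalIdealPow
import HarnessLib

/-!
# Diagonal and linear forms `∑ⱼ C(cⱼ)·Xⱼ^q` in a power series ring `R⟦X_σ⟧`

`Literature/RingTheory/MvPowerSeries/DiagonalForms.lean` (grouping namespace
`Literature.RingTheory.MvPowerSeries.DiagonalForms`). Everything here is PROVED (no definition, no
named fact). The objects are the finite sums `∑ j ∈ s, C (c j) * X j ^ q` ("diagonal `q`-forms";
`q = 1`: linear forms `∑ j ∈ s, C (d j) * X j`) in `MvPowerSeries σ R`:

1. single terms: `C_mul_X_pow_eq_monomial`, `coeff_C_mul_X_pow`, `coeff_single_one_C_add_X`,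
   `constantCoeff_C_add_X`; exponents of degree one: `exists_eq_single_of_degree_eq_one`,
   `degree_eq_one_iff`;
2. coefficients: `coeff_single_sum_C_mul_X_pow` (the coefficient at `q·eᵢ` is `cᵢ`, `q ≥ 1`),
   `coeff_sum_C_mul_X_pow_of_forall_ne` (all other coefficients vanish), the `q = 1` forms
   `coeff_single_sum_C_mul_X` / `coeff_sum_C_mul_X_of_forall_ne`, `constantCoeff_sum_C_mul_X_pow`,
   injectivity `sum_C_mul_X_pow_eq_zero_iff`;
3. order: `le_order_sum_C_mul_X_pow`, `order_sum_C_mul_X_pow` (`= q` as soon as one `cᵢ ≠ 0`);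
4. Frobenius (exponential characteristic `p`): `sum_C_mul_X_pow_pow_expChar_pow`
   (`(∑ C(cⱼ) Xⱼ^q)^(p^e) = ∑ C(cⱼ^(p^e)) Xⱼ^(q·p^e)`) and the linear case `sum_C_mul_X_pow_expChar_pow`;
5. jets over a field `K` (with `Literature.RingTheory.MvPowerSeries.Jets`): `sum_C_mul_X_pow_mem_maximalIdeal_pow`,
   `sum_C_mul_X_pow_not_mem_maximalIdeal_pow_succ`, the LINEAR PART `sub_linearPart_mem_maximalIdeal_sq`
   (`y ∈ 𝔪 ⇒ y − ∑ⱼ C(coeff eⱼ y) Xⱼ ∈ 𝔪²`) and the DIAGONAL PART `sub_diagonalPart_mem_maximalIdeal_pow_succ`.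

These are the standard first facts on initial forms of formal power series (the `𝔪`-adic filtration of
`K⟦X⟧` is the order filtration, the initial form of an element of order `q` is its degree-`q` component;
Zariski–Samuel, *Commutative Algebra* II, Ch. VII §1, pp. 129–131) and the Frobenius identity
`(∑ aᵢ)^(p^e) = ∑ aᵢ^(p^e)` in characteristic `p` (Lang, *Algebra*, Ch. V §6). Written for the HIRONAKA-L
lane (summit `ResolutionOfSingularities`), where they were re-proved privately in
`Hironaka2017/Proofs/S06BaseHike/{LLHeadCriterionPowerSeries, LLPreheadR2Structure, LLHeadCriterionImperfect,
Eq55ConvNonClosed}` (`ρ^e`-heads `∑ C(cⱼ^{p^e}) Xⱼ^{p^e}` of LL-head criteria) and in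
`Resolution/{HasseSchmidtChartOrder, SmoothPointFrobeniusCongruence, SmoothPointOrderCriterion}`
(`coeff_single_C_add_X`); the polynomial analogues are `Literature.RingTheory.MvPolynomial.LinearFormsCoeff`
and `Literature.AlgebraicGeometry.Resolution.PowersOfLinearForms`.

## References

* [ZariskiSamuel1960] O. Zariski, P. Samuel, Commutative Algebra II, GTM 29, Ch. VII §1.
* [Lang2002] S. Lang, Algebra, GTM 211, Ch. V §6 (Frobenius in characteristic `p`).
-/

noncomputable section

open MvPowerSeries Finsupp IsLocalRing

namespace Literature.RingTheory.MvPowerSeries.DiagonalForms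

/-! ### 1. Exponents of degree one; single terms `C a * X s ^ n` -/

section Exponents

variable {σ : Type*}

/-- An exponent vector of total degree `1` is a unit vector `e_j`.
[cite: ZariskiSamuel1960, Vol. II Ch. VII §1 p. 129] -/
theorem exists_eq_single_of_degree_eq_one {β : σ →₀ ℕ} (hβ : β.degree = 1) : ∃ j, β = single j 1 := by
  classical
  have hne : β ≠ 0 := by
    rintro rfl
    rw [map_zero] at hβ
    exact zero_ne_one hβ
  obtain ⟨j, hj⟩ := Finsupp.ne_iff.mp hne
  rw [Finsupp.coe_zero, Pi.zero_apply] at hj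
  have hj1 : β j = 1 := le_antisymm (le_of_le_of_eq (Finsupp.le_degree j β) hβ) (Nat.pos_of_ne_zero hj)
  refine ⟨j, ?_⟩
  have hle : single j (β j) ≤ β := Finsupp.single_le_iff.mpr le_rfl
  have hrest : (β - single j (β j)).degree = 0 := by
    have h := congrArg Finsupp.degree (tsub_add_cancel_of_le hle)
    rw [map_add, degree_single, hβ] at h
    omega
  have hzero : β - single j (β j) = 0 := (Finsupp.degree_eq_zero_iff _).mp hrest
  rw [← tsub_add_cancel_of_le hle, hzero, zero_add, hj1]

/-- `|β| = 1 ↔ β = e_j` for some `j`. [cite: ZariskiSamuel1960, Vol. II Ch. VII §1 p. 129] -/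
theorem degree_eq_one_iff (β : σ →₀ ℕ) : β.degree = 1 ↔ ∃ j, β = single j 1 := by
  refine ⟨exists_eq_single_of_degree_eq_one, ?_⟩
  rintro ⟨j, rfl⟩
  exact degree_single j 1

/-- An exponent of degree `< q` is not of the form `q • e_i` (`q ≥ 1` automatic).
[cite: ZariskiSamuel1960, Vol. II Ch. VII §1 p. 129] -/
theorem ne_single_of_degree_lt {β : σ →₀ ℕ} {q : ℕ} (hβ : β.degree < q) (i : σ) : β ≠ single i q := by
  rintro rfl
  rw [degree_single] at hβ
  exact lt_irrefl _ hβ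

end Exponents

section Semiring

variable {σ : Type*} {R : Type*} [Semiring R]

/-- `C a * X s ^ n = monomial (n • e_s) a` in `R⟦X⟧`. [cite: ZariskiSamuel1960, Vol. II Ch. VII §1 p. 129] -/
theorem C_mul_X_pow_eq_monomial (a : R) (s : σ) (n : ℕ) :
    C a * (X s : MvPowerSeries σ R) ^ n = monomial (single s n) a := by
  rw [X_pow_eq, ← smul_eq_C_mul, ← map_smul, smul_eq_mul, mul_one]

/-- `C a * X s = monomial e_s a`. [cite: ZariskiSamuel1960, Vol. II Ch. VII §1 p. 129] -/
theorem C_mul_X_eq_monomial (a : R) (s : σ) : C a * (X s : MvPowerSeries σ R) = monomial (single s 1) a := by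
  rw [← C_mul_X_pow_eq_monomial, pow_one]

/-- Coefficients of the single term `C a * X s ^ n`. [cite: ZariskiSamuel1960, Vol. II Ch. VII §1 p. 129] -/
theorem coeff_C_mul_X_pow [DecidableEq σ] (m : σ →₀ ℕ) (a : R) (s : σ) (n : ℕ) :
    coeff m (C a * (X s : MvPowerSeries σ R) ^ n) = if m = single s n then a else 0 := by
  rw [C_mul_X_pow_eq_monomial, coeff_monomial]

/-- Degree-one coefficients of `C a + X i`: `coeff e_j (C a + X i) = δ_{ij}`.
[cite: ZariskiSamuel1960, Vol. II Ch. VII §1 p. 129] -/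
theorem coeff_single_one_C_add_X [DecidableEq σ] (a : R) (i j : σ) :
    coeff (single j 1) (C a + X i : MvPowerSeries σ R) = if i = j then 1 else 0 := by
  rw [map_add, coeff_C, if_neg (single_ne_zero.mpr one_ne_zero), zero_add, coeff_index_single_X]
  by_cases h : i = j
  · rw [if_pos h, if_pos h.symm]
  · rw [if_neg h, if_neg (Ne.symm h)]

/-- `constantCoeff (C a + X i) = a`. [cite: ZariskiSamuel1960, Vol. II Ch. VII §1 p. 129] -/
theorem constantCoeff_C_add_X (a : R) (i : σ) : constantCoeff (C a + X i : MvPowerSeries σ R) = a := by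
  rw [map_add, constantCoeff_C, constantCoeff_X, add_zero]

/-! ### 2. Coefficients of `∑ j ∈ s, C (c j) * X j ^ q` -/

/-- The coefficient of `∑_{j ∈ s} C(c_j) X_j^q` at `q • e_i` is `c_i` for `i ∈ s` (`q ≥ 1`).
[cite: ZariskiSamuel1960, Vol. II Ch. VII §1 p. 130] -/
theorem coeff_single_finsetSum_C_mul_X_pow {s : Finset σ} {i : σ} (hi : i ∈ s) (c : σ → R) {q : ℕ}
    (hq : 0 < q) : coeff (single i q) (∑ j ∈ s, C (c j) * (X j : MvPowerSeries σ R) ^ q) = c i := by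
  classical
  rw [map_sum, Finset.sum_eq_single i]
  · rw [coeff_C_mul_X_pow, if_pos rfl]
  · intro j _ hji
    rw [coeff_C_mul_X_pow, if_neg]
    exact fun h => hji ((single_left_injective hq.ne') h).symm
  · exact fun h => absurd hi h

/-- The coefficient of `∑_{j ∈ s} C(c_j) X_j^q` at `q • e_i` vanishes for `i ∉ s` (`q ≥ 1`).
[cite: ZariskiSamuel1960, Vol. II Ch. VII §1 p. 130] -/
theorem coeff_single_finsetSum_C_mul_X_pow_of_not_mem {s : Finset σ} {i : σ} (hi : i ∉ s) (c : σ → R)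
    {q : ℕ} (hq : 0 < q) : coeff (single i q) (∑ j ∈ s, C (c j) * (X j : MvPowerSeries σ R) ^ q) = 0 := by
  classical
  rw [map_sum]
  refine Finset.sum_eq_zero fun j hj => ?_
  rw [coeff_C_mul_X_pow, if_neg]
  intro h
  exact hi (((single_left_injective hq.ne') h) ▸ hj)

/-- All coefficients of `∑_{j ∈ s} C(c_j) X_j^q` off the exponents `q • e_i`, `i ∈ s`, vanish.
[cite: ZariskiSamuel1960, Vol. II Ch. VII §1 p. 130] -/
theorem coeff_finsetSum_C_mul_X_pow_of_forall_ne (s : Finset σ) (c : σ → R) (q : ℕ) {β : σ →₀ ℕ}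
    (hβ : ∀ i ∈ s, β ≠ single i q) : coeff β (∑ j ∈ s, C (c j) * (X j : MvPowerSeries σ R) ^ q) = 0 := by
  classical
  rw [map_sum]
  refine Finset.sum_eq_zero fun j hj => ?_
  rw [coeff_C_mul_X_pow, if_neg (hβ j hj)]

variable [Fintype σ]

/-- The coefficient of `∑ⱼ C(c_j) X_j^q` at `q • e_i` is `c_i` (`q ≥ 1`).
[cite: ZariskiSamuel1960, Vol. II Ch. VII §1 p. 130] -/
theorem coeff_single_sum_C_mul_X_pow (c : σ → R) {q : ℕ} (hq : 0 < q) (i : σ) :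
    coeff (single i q) (∑ j, C (c j) * (X j : MvPowerSeries σ R) ^ q) = c i :=
  coeff_single_finsetSum_C_mul_X_pow (Finset.mem_univ i) c hq

/-- All coefficients of `∑ⱼ C(c_j) X_j^q` off the diagonal exponents `q • e_i` vanish.
[cite: ZariskiSamuel1960, Vol. II Ch. VII §1 p. 130] -/
theorem coeff_sum_C_mul_X_pow_of_forall_ne (c : σ → R) (q : ℕ) {β : σ →₀ ℕ} (hβ : ∀ i, β ≠ single i q) :
    coeff β (∑ j, C (c j) * (X j : MvPowerSeries σ R) ^ q) = 0 :=
  coeff_finsetSum_C_mul_X_pow_of_forall_ne _ c q fun i _ => hβ i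

/-- Coefficients of `∑ⱼ C(c_j) X_j^q` in degree `≠ q` vanish. [cite: ZariskiSamuel1960, Vol. II Ch. VII §1 p. 130] -/
theorem coeff_sum_C_mul_X_pow_of_degree_ne (c : σ → R) {q : ℕ} {β : σ →₀ ℕ} (hβ : β.degree ≠ q) :
    coeff β (∑ j, C (c j) * (X j : MvPowerSeries σ R) ^ q) = 0 :=
  coeff_sum_C_mul_X_pow_of_forall_ne c q fun i h => hβ (by rw [h, degree_single])

/-- The coefficient of the linear form `∑ⱼ C(d_j) X_j` at `e_i` is `d_i`.
[cite: ZariskiSamuel1960, Vol. II Ch. VII §1 p. 130] -/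
theorem coeff_single_sum_C_mul_X (d : σ → R) (i : σ) :
    coeff (single i 1) (∑ j, C (d j) * (X j : MvPowerSeries σ R)) = d i := by
  simpa only [pow_one] using coeff_single_sum_C_mul_X_pow d one_pos i

/-- All coefficients of the linear form `∑ⱼ C(d_j) X_j` off the unit vectors vanish.
[cite: ZariskiSamuel1960, Vol. II Ch. VII §1 p. 130] -/
theorem coeff_sum_C_mul_X_of_forall_ne (d : σ → R) {β : σ →₀ ℕ} (hβ : ∀ i, β ≠ single i 1) :
    coeff β (∑ j, C (d j) * (X j : MvPowerSeries σ R)) = 0 := by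
  simpa only [pow_one] using coeff_sum_C_mul_X_pow_of_forall_ne d 1 hβ

/-- Coefficients of the linear form `∑ⱼ C(d_j) X_j` in degree `≠ 1` vanish.
[cite: ZariskiSamuel1960, Vol. II Ch. VII §1 p. 130] -/
theorem coeff_sum_C_mul_X_of_degree_ne (d : σ → R) {β : σ →₀ ℕ} (hβ : β.degree ≠ 1) :
    coeff β (∑ j, C (d j) * (X j : MvPowerSeries σ R)) = 0 := by
  simpa only [pow_one] using coeff_sum_C_mul_X_pow_of_degree_ne d hβ

/-- A diagonal `q`-form with `q ≥ 1` has no constant term. [cite: ZariskiSamuel1960, Vol. II Ch. VII §1 p. 130] -/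
theorem constantCoeff_sum_C_mul_X_pow (c : σ → R) {q : ℕ} (hq : 0 < q) :
    constantCoeff (∑ j, C (c j) * (X j : MvPowerSeries σ R) ^ q) = 0 := by
  rw [← coeff_zero_eq_constantCoeff_apply]
  exact coeff_sum_C_mul_X_pow_of_degree_ne c (by rw [map_zero]; exact hq.ne)

/-- A linear form has no constant term. [cite: ZariskiSamuel1960, Vol. II Ch. VII §1 p. 130] -/
theorem constantCoeff_sum_C_mul_X (d : σ → R) :
    constantCoeff (∑ j, C (d j) * (X j : MvPowerSeries σ R)) = 0 := by
  simpa only [pow_one] using constantCoeff_sum_C_mul_X_pow d one_pos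

/-- `∑ⱼ C(c_j) X_j^q = 0 ↔ c = 0` (`q ≥ 1`). [cite: ZariskiSamuel1960, Vol. II Ch. VII §1 p. 130] -/
theorem sum_C_mul_X_pow_eq_zero_iff {c : σ → R} {q : ℕ} (hq : 0 < q) :
    ∑ j, C (c j) * (X j : MvPowerSeries σ R) ^ q = 0 ↔ c = 0 := by
  refine ⟨fun h => funext fun i => ?_, ?_⟩
  · rw [← coeff_single_sum_C_mul_X_pow c hq i, h, map_zero, Pi.zero_apply]
  · rintro rfl
    exact Finset.sum_eq_zero fun j _ => by rw [Pi.zero_apply, map_zero, zero_mul]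

/-- `∑ⱼ C(d_j) X_j = 0 ↔ d = 0`. [cite: ZariskiSamuel1960, Vol. II Ch. VII §1 p. 130] -/
theorem sum_C_mul_X_eq_zero_iff {d : σ → R} : ∑ j, C (d j) * (X j : MvPowerSeries σ R) = 0 ↔ d = 0 := by
  simpa only [pow_one] using sum_C_mul_X_pow_eq_zero_iff (c := d) one_pos

/-! ### 3. Order -/

/-- A diagonal `q`-form has order `≥ q`. [cite: ZariskiSamuel1960, Vol. II Ch. VII §1 p. 130] -/
theorem le_order_sum_C_mul_X_pow (c : σ → R) (q : ℕ) :
    (q : ℕ∞) ≤ (∑ j, C (c j) * (X j : MvPowerSeries σ R) ^ q).order :=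
  nat_le_order fun _ hβ => coeff_sum_C_mul_X_pow_of_degree_ne c hβ.ne

/-- A nonzero diagonal `q`-form has order exactly `q`: `ord (∑ C(c_j) X_j^q) = q` as soon as some `c_i ≠ 0`.
[cite: ZariskiSamuel1960, Vol. II Ch. VII §1 p. 130] -/
theorem order_sum_C_mul_X_pow {c : σ → R} {q : ℕ} (hq : 0 < q) (hc : c ≠ 0) :
    (∑ j, C (c j) * (X j : MvPowerSeries σ R) ^ q).order = (q : ℕ∞) := by
  obtain ⟨i, hi⟩ := Function.ne_iff.mp hc
  refine order_eq_nat.mpr ⟨⟨single i q, ?_, degree_single i q⟩, fun β hβ => coeff_sum_C_mul_X_pow_of_degree_ne c hβ.ne⟩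
  rwa [coeff_single_sum_C_mul_X_pow c hq i]

/-- A nonzero linear form has order `1`. [cite: ZariskiSamuel1960, Vol. II Ch. VII §1 p. 130] -/
theorem order_sum_C_mul_X {d : σ → R} (hd : d ≠ 0) : (∑ j, C (d j) * (X j : MvPowerSeries σ R)).order = 1 := by
  have h := order_sum_C_mul_X_pow (R := R) (c := d) one_pos hd
  simpa only [pow_one, Nat.cast_one] using h

end Semiring

/-! ### 4. Frobenius: `(∑ C(c_j) X_j^q)^(p^e) = ∑ C(c_j^(p^e)) X_j^(q·p^e)` -/

section Frobenius

variable {σ : Type*} {R : Type*} [CommSemiring R] (p : ℕ) [ExpChar R p]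

/-- `R⟦X_σ⟧` has the exponential characteristic of `R`. [cite: Lang2002, Ch. V §6] -/
theorem expChar_mvPowerSeries : ExpChar (MvPowerSeries σ R) p :=
  expChar_of_injective_ringHom (f := (C : R →+* MvPowerSeries σ R)) C_injective p

/-- Frobenius of a diagonal form over a ring of exponential characteristic `p`:
`(∑_{j ∈ s} C(c_j) X_j^q)^(p^e) = ∑_{j ∈ s} C(c_j^(p^e)) X_j^(q·p^e)`. [cite: Lang2002, Ch. V §6] -/
theorem finsetSum_C_mul_X_pow_pow_expChar_pow (s : Finset σ) (c : σ → R) (q e : ℕ) :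
    (∑ j ∈ s, C (c j) * (X j : MvPowerSeries σ R) ^ q) ^ p ^ e
      = ∑ j ∈ s, C (c j ^ p ^ e) * (X j : MvPowerSeries σ R) ^ (q * p ^ e) := by
  haveI := expChar_mvPowerSeries (σ := σ) (R := R) p
  rw [sum_pow_char_pow]
  refine Finset.sum_congr rfl fun j _ => ?_
  rw [mul_pow, ← map_pow, ← pow_mul]

variable [Fintype σ]

/-- Frobenius of a diagonal form: `(∑ⱼ C(c_j) X_j^q)^(p^e) = ∑ⱼ C(c_j^(p^e)) X_j^(q·p^e)`. [cite: Lang2002, Ch. V §6] -/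
theorem sum_C_mul_X_pow_pow_expChar_pow (c : σ → R) (q e : ℕ) :
    (∑ j, C (c j) * (X j : MvPowerSeries σ R) ^ q) ^ p ^ e = ∑ j, C (c j ^ p ^ e) * (X j : MvPowerSeries σ R) ^ (q * p ^ e) :=
  finsetSum_C_mul_X_pow_pow_expChar_pow p _ c q e

/-- Frobenius of a linear form: `(∑ⱼ C(d_j) X_j)^(p^e) = ∑ⱼ C(d_j^(p^e)) X_j^(p^e)` — the `ρ^e`-image of a
linear form is the diagonal `p^e`-form of the `p^e`-th powers of its coefficients. [cite: Lang2002, Ch. V §6] -/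
theorem sum_C_mul_X_pow_expChar_pow (d : σ → R) (e : ℕ) :
    (∑ j, C (d j) * (X j : MvPowerSeries σ R)) ^ p ^ e = ∑ j, C (d j ^ p ^ e) * (X j : MvPowerSeries σ R) ^ p ^ e := by
  simpa only [pow_one, one_mul] using sum_C_mul_X_pow_pow_expChar_pow p d 1 e

end Frobenius

/-! ### 5. Jets over a field: linear part and diagonal part -/

section Field

variable {σ : Type*} [Fintype σ] {K : Type*} [Field K]

open Literature.RingTheory.MvPowerSeries.Jets

/-- A diagonal `q`-form lies in `𝔪 ^ q`. [cite: ZariskiSamuel1960, Vol. II Ch. VII §1 p. 130] -/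
theorem sum_C_mul_X_pow_mem_maximalIdeal_pow (c : σ → K) (q : ℕ) :
    ∑ j, C (c j) * (X j : MvPowerSeries σ K) ^ q ∈ maximalIdeal (MvPowerSeries σ K) ^ q :=
  mem_maximalIdeal_pow_of_le_order (le_order_sum_C_mul_X_pow c q)

/-- A linear form lies in `𝔪`. [cite: ZariskiSamuel1960, Vol. II Ch. VII §1 p. 130] -/
theorem sum_C_mul_X_mem_maximalIdeal (d : σ → K) :
    ∑ j, C (d j) * (X j : MvPowerSeries σ K) ∈ maximalIdeal (MvPowerSeries σ K) :=
  mem_maximalIdeal_iff_constantCoeff_eq_zero.mpr (constantCoeff_sum_C_mul_X d)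

/-- A diagonal `q`-form (`q ≥ 1`) with a nonzero coefficient is NOT in `𝔪 ^ (q+1)`: its order is exactly `q`.
[cite: ZariskiSamuel1960, Vol. II Ch. VII §1 p. 130] -/
theorem sum_C_mul_X_pow_not_mem_maximalIdeal_pow_succ {c : σ → K} {q : ℕ} (hq : 0 < q) (hc : c ≠ 0) :
    ∑ j, C (c j) * (X j : MvPowerSeries σ K) ^ q ∉ maximalIdeal (MvPowerSeries σ K) ^ (q + 1) := by
  intro h
  have h' := le_order_of_mem_maximalIdeal_pow h
  rw [order_sum_C_mul_X_pow hq hc, Nat.cast_le] at h'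
  omega

/-- **Linear part.** For `y ∈ 𝔪`, `y` minus its linear part `∑ⱼ C(coeff e_j y) X_j` lies in `𝔪²`.
[cite: ZariskiSamuel1960, Vol. II Ch. VII §1 p. 130] -/
theorem sub_linearPart_mem_maximalIdeal_sq {y : MvPowerSeries σ K} (hy : y ∈ maximalIdeal (MvPowerSeries σ K)) :
    y - ∑ j, C (coeff (single j 1) y) * X j ∈ maximalIdeal (MvPowerSeries σ K) ^ 2 := by
  refine mem_maximalIdeal_pow_of_coeff_eq_zero fun β hβ => ?_
  rw [map_sub, sub_eq_zero]
  rcases Nat.lt_or_ge β.degree 1 with h0 | h1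
  · have hβ0 : β = 0 := (Finsupp.degree_eq_zero_iff _).mp (by omega)
    subst hβ0
    rw [coeff_zero_eq_constantCoeff_apply, mem_maximalIdeal_iff_constantCoeff_eq_zero.mp hy,
      coeff_zero_eq_constantCoeff_apply, constantCoeff_sum_C_mul_X]
  · obtain ⟨j, rfl⟩ := exists_eq_single_of_degree_eq_one (le_antisymm (by omega) h1)
    rw [coeff_single_sum_C_mul_X]

omit [Fintype σ] in
/-- The linear part of `y ∈ 𝔪²` vanishes: all degree-one coefficients of `y` are zero.
[cite: ZariskiSamuel1960, Vol. II Ch. VII §1 p. 130] -/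
theorem coeff_single_one_eq_zero_of_mem_maximalIdeal_sq {y : MvPowerSeries σ K}
    (hy : y ∈ maximalIdeal (MvPowerSeries σ K) ^ 2) (j : σ) : coeff (single j 1) y = 0 :=
  coeff_eq_zero_of_mem_maximalIdeal_pow hy (by rw [degree_single]; exact one_lt_two)

/-- `y ∈ 𝔪` lies in `𝔪²` iff its linear part vanishes. [cite: ZariskiSamuel1960, Vol. II Ch. VII §1 p. 130] -/
theorem mem_maximalIdeal_sq_iff_forall_coeff_single_one_eq_zero {y : MvPowerSeries σ K}
    (hy : y ∈ maximalIdeal (MvPowerSeries σ K)) :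
    y ∈ maximalIdeal (MvPowerSeries σ K) ^ 2 ↔ ∀ j, coeff (single j 1) y = 0 := by
  refine ⟨coeff_single_one_eq_zero_of_mem_maximalIdeal_sq, fun h => ?_⟩
  have h' := sub_linearPart_mem_maximalIdeal_sq hy
  have h0 : ∑ j, C (coeff (single j 1) y) * (X j : MvPowerSeries σ K) = 0 :=
    Finset.sum_eq_zero fun j _ => by rw [h j, map_zero, zero_mul]
  rwa [h0, sub_zero] at h'

/-- **Diagonal part.** If `g ∈ 𝔪 ^ q` (`q ≥ 1`) has no degree-`q` coefficients off the diagonal exponents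
`q • e_i`, then `g` minus its diagonal part `∑ᵢ C(coeff (q•e_i) g) X_i^q` lies in `𝔪 ^ (q+1)`.
[cite: ZariskiSamuel1960, Vol. II Ch. VII §1 p. 130] -/
theorem sub_diagonalPart_mem_maximalIdeal_pow_succ {q : ℕ} (hq : 0 < q) {g : MvPowerSeries σ K}
    (hgq : g ∈ maximalIdeal (MvPowerSeries σ K) ^ q)
    (hdiag : ∀ γ : σ →₀ ℕ, γ.degree = q → (∀ i, γ ≠ single i q) → coeff γ g = 0) :
    g - ∑ i, C (coeff (single i q) g) * X i ^ q ∈ maximalIdeal (MvPowerSeries σ K) ^ (q + 1) := by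
  refine mem_maximalIdeal_pow_of_coeff_eq_zero fun β hβ => ?_
  rw [map_sub, sub_eq_zero]
  rcases Nat.lt_or_ge β.degree q with hlt | hge
  · rw [coeff_eq_zero_of_mem_maximalIdeal_pow hgq hlt,
      coeff_sum_C_mul_X_pow_of_forall_ne _ _ (ne_single_of_degree_lt hlt)]
  · have hβq : β.degree = q := by omega
    by_cases hβ' : ∀ i, β ≠ single i q
    · rw [hdiag β hβq hβ', coeff_sum_C_mul_X_pow_of_forall_ne _ _ hβ']
    · simp only [not_forall, not_not] at hβ'
      obtain ⟨i, rfl⟩ := hβ'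
      rw [coeff_single_sum_C_mul_X_pow _ hq]

/-- The general degree-`q` remainder: `g ∈ 𝔪 ^ q` minus ANY series `h` with the same coefficients in degree `q`
lies in `𝔪 ^ (q+1)` when `h ∈ 𝔪 ^ q`. [cite: ZariskiSamuel1960, Vol. II Ch. VII §1 p. 130] -/
theorem sub_mem_maximalIdeal_pow_succ_of_coeff_eq {q : ℕ} {g h : MvPowerSeries σ K}
    (hg : g ∈ maximalIdeal (MvPowerSeries σ K) ^ q) (hh : h ∈ maximalIdeal (MvPowerSeries σ K) ^ q)
    (hcoeff : ∀ γ : σ →₀ ℕ, γ.degree = q → coeff γ g = coeff γ h) :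
    g - h ∈ maximalIdeal (MvPowerSeries σ K) ^ (q + 1) := by
  refine mem_maximalIdeal_pow_of_coeff_eq_zero fun β hβ => ?_
  rw [map_sub, sub_eq_zero]
  rcases Nat.lt_or_ge β.degree q with hlt | hge
  · rw [coeff_eq_zero_of_mem_maximalIdeal_pow hg hlt, coeff_eq_zero_of_mem_maximalIdeal_pow hh hlt]
  · exact hcoeff β (by omega)

end Field

end Literature.RingTheory.MvPowerSeries.DiagonalForms

end
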